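import Mathlib.Combinatorics.Pigeonhole
import Summits.QuantumAdvantage.QuantumAdvantage.Theorems.NearExactIsExact.Negative.FibreResidueRM
import Summits.QuantumAdvantage.QuantumAdvantage.Theorems.NearExactIsExact.Negative.MM59Local
import Summits.QuantumAdvantage.QuantumAdvantage.Theorems.NearExactIsExact.Negative.FlatEqsFive
import Summits.QuantumAdvantage.QuantumAdvantage.Theorems.NearExactIsExact.Negative.TypeOSixtyOneFourteen

/-!
# `NearExactIsExact` (stmt-QuantumAdvantage-14043) — THEOREM MM59-W: type-O Maiorana–McFarland functions over a quadratic map have capacity `≤ 59/64` (`n = 14`)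

B2b disprover cell (gen 27). HONEST FRAMING: a kernel-checked ceiling for one explicit habitat of the
`n = 14` window question — NOT summit progress, and NOT a statement about general cubic `g`.

Setting (`Negative.NoCaseAMM59`): `g(x‖y) = x·φ(y) ⊕ h(y)` on `5 + 9` bits, `φ = (q₀,…,q₄) : 𝔽₂⁹ → 𝔽₂⁵`
QUADRATIC, `h` arbitrary; `W_g(a‖b) = 2⁵ f_a(b)` with `f_a(b) = Σ_{φ(y)=a} ε_y (-1)^{b·y}`, `ε = (-1)^h`.
TYPE O means: all `f_a(b)` odd (all fibres odd).

**THEOREM MM59-W** (`typeO_mm59_forrelation_le`): type O ⇒ `Φ(f,g) ≤ 59/64` for EVERY Boolean `f`.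
Proof: (budget, `fl_budget5` + `tw12_pt`) `Σ_z (u_z - 4s_z)² = 2¹⁹(1-Φ)` costs `≥ 1` per point and `≥ 9` on
`E = {u ≡ ±1 (mod 8)}`, so `Φ ≤ 31/32 - #E/2¹⁶`; (`Negative.FibreResidueRM`) on each fibre the exceptional set
`E_a` is empty or has `≥ 128` points, and `E_a = ∅` iff fibre `a` is CLEAN (all `f_a(b) ≡ ±3 (mod 8)`);
(`four_of_nine`, pigeonhole on `XOR`s of pairs) nine clean `a ∈ 𝔽₂⁵` contain four points `a₁, a₁⊕s, a₁⊕t,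
a₁⊕s⊕t` of an affine `2`-flat; (`no_clean_flat` = `Negative.FlatEqsFive.flat_eqs` + `Negative.MM59Local`) the
four fibres above an affine `2`-flat are never all clean. Hence `≤ 8` clean fibres, `≥ 24` dirty ones,
`#E ≥ 24·128 = 3072`, `Φ ≤ 31/32 - 3/64 = 59/64`. (Case A of MM59 is the sub-case "all 32 fibres clean".)
Sources: [this work]; folklore tools as cited in the imported files. Standard axioms only.
-/

set_option linter.dupNamespace false -- D-0017: single-problem summit ⇒ `QuantumAdvantage.QuantumAdvantage` by design

namespace Summit.QuantumAdvantage.QuantumAdvantage.Theorems.NearExactIsExact.Negative.TypeOMM59WindowFourteen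

open Finset
open Literature.Computability.QuantumComplexity
open Literature.Computability.QuantumComplexity.DerivativeWalsh (W)
open Summit.QuantumAdvantage.QuantumAdvantage.Theorems.CubicForrelation.NearExactIsExact
open Summit.QuantumAdvantage.QuantumAdvantage.Theorems.NearExactIsExact.Negative.CentroidMoments
open Summit.QuantumAdvantage.QuantumAdvantage.Theorems.NearExactIsExact.Negative.MM59
open Summit.QuantumAdvantage.QuantumAdvantage.Theorems.NearExactIsExact.Negative.FibreResidueRM (exc_card_ge)
open Summit.QuantumAdvantage.QuantumAdvantage.Theorems.NearExactIsExact.Negative.MM59Local (no_clean_quad)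
open Summit.QuantumAdvantage.QuantumAdvantage.Theorems.NearExactIsExact.Negative.FlatEqsFive

/-! ### No four clean fibres over an affine `2`-flat -/

section Flat

variable {q : Fin 5 → (Fin 9 → Bool) → Bool} {ε : (Fin 9 → Bool) → ℤ}

/-- **No clean `2`-flat.** For a quadratic `φ = (q₀,…,q₄) : 𝔽₂⁹ → 𝔽₂⁵` and odd weights `ε`, the four
fibres above an affine `2`-flat `{a₁ ⊕ us ⊕ vt}` (`s, t ≠ 0`, `s ≠ t`) are never all clean
(all `f_a(b) ≡ ±3 (mod 8)`). [this work] -/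
theorem no_clean_flat (hq : ∀ i, IsDegLeFun 2 (q i)) (hε : ∀ y, Odd (ε y)) (a₁ s t : Fin 5 → Bool)
    (hs : s ≠ fun _ => false) (ht : t ≠ fun _ => false) (hst : s ≠ t)
    (hA : ∀ (uv : Bool × Bool) (b : Fin 9 → Bool),
      fs q ε (fun k => a₁ k ^^ ((uv.1 && s k) ^^ (uv.2 && t k))) b % 8 = 3 ∨
      fs q ε (fun k => a₁ k ^^ ((uv.1 && s k) ^^ (uv.2 && t k))) b % 8 = 5) : False := by
  obtain ⟨i, j, hij, α, β, hiff⟩ := flat_eqs s t hs ht hst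
  set P : Bool × Bool → (Fin 5 → Bool) := fun uv k => a₁ k ^^ ((uv.1 && s k) ^^ (uv.2 && t k)) with hP
  have indep : ∀ w₁ w₂ : Bool, (∀ k, ((w₁ && s k) ^^ (w₂ && t k)) = false) → w₁ = false ∧ w₂ = false := by
    intro w₁ w₂ h
    cases w₁ <;> cases w₂
    · exact ⟨rfl, rfl⟩
    · exact absurd (funext fun k => in_ft _ _ (h k)) ht
    · exact absurd (funext fun k => in_tf _ _ (h k)) hs
    · exact absurd (funext fun k => in_tt _ _ (h k)) hst
  have hPinj : Function.Injective P := by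
    rintro ⟨u, v⟩ ⟨u', v'⟩ h
    have hk : ∀ k, (((u ^^ u') && s k) ^^ ((v ^^ v') && t k)) = false := fun k =>
      in_diff _ _ _ _ _ _ (xor_cancel _ _ _ (congr_fun h k))
    obtain ⟨hu, hv⟩ := indep _ _ hk
    rw [xor_eq_false _ _ hu, xor_eq_false _ _ hv]
  set c : Fin 5 → (Fin 9 → Bool) → Bool :=
    fun k y => ((q k y ^^ a₁ k) ^^ (α k && (q i y ^^ a₁ i))) ^^ (β k && (q j y ^^ a₁ j)) with hc
  have h1 : ∀ k', IsDegLeFun 2 (fun y => q k' y ^^ a₁ k') := fun k' => tb_isDegLeFun_xor_const (hq k') _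
  have h2 : ∀ (b : Bool) (k' : Fin 5), IsDegLeFun 2 (fun y => b && (q k' y ^^ a₁ k')) := fun b k' => by
    cases b
    · exact isDegLeFun_const 2 false
    · exact h1 k'
  have hcdeg : ∀ k, IsDegLeFun 2 (c k) := fun k =>
    bb_isDegLeFun_bxor (bb_isDegLeFun_bxor (h1 k) (h2 (α k) i)) (h2 (β k) j)
  have hcP : ∀ y, (∀ k ∈ univ \ {i, j}, c k y = false) ↔ ∃ uv, y ∈ fib q (P uv) := by
    intro y
    have e1 : (∀ k ∈ univ \ {i, j}, c k y = false) ↔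
        (∀ k, k ≠ i → k ≠ j → (((fun k => q k y ^^ a₁ k) k ^^ (α k && (fun k => q k y ^^ a₁ k) i)) ^^
          (β k && (fun k => q k y ^^ a₁ k) j)) = false) := by
      simp only [mem_sdiff, mem_univ, true_and, mem_insert, mem_singleton, not_or, hc]
      exact ⟨fun h k hki hkj => h k ⟨hki, hkj⟩, fun h k hk => h k hk.1 hk.2⟩
    rw [e1, hiff (fun k => q k y ^^ a₁ k)]
    constructor
    · rintro (h | h | h | h)
      · exact ⟨(false, false), mem_fib.mpr fun k => by
          rw [xor_solve _ _ _ (congr_fun h k)]; simp [hP]⟩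
      · exact ⟨(true, false), mem_fib.mpr fun k => by
          rw [xor_solve _ _ _ (congr_fun h k)]; simp [hP]⟩
      · exact ⟨(false, true), mem_fib.mpr fun k => by
          rw [xor_solve _ _ _ (congr_fun h k)]; simp [hP]⟩
      · exact ⟨(true, true), mem_fib.mpr fun k => by
          rw [xor_solve _ _ _ (congr_fun h k)]; simp [hP]⟩
    · rintro ⟨⟨u, v⟩, huv⟩
      have hk : ∀ k, q k y = P (u, v) k := mem_fib.mp huv
      cases u <;> cases v
      · left
        funext k
        show (q k y ^^ a₁ k) = false
        rw [hk k]
        exact pt_ff _ _ _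
      · right; right; left
        funext k
        show (q k y ^^ a₁ k) = t k
        rw [hk k]
        exact pt_ft _ _ _
      · right; left
        funext k
        show (q k y ^^ a₁ k) = s k
        rw [hk k]
        exact pt_tf _ _ _
      · right; right; right
        funext k
        show (q k y ^^ a₁ k) = (s k ^^ t k)
        rw [hk k]
        exact pt_tt _ _ _
  have hK : #(univ \ ({i, j} : Finset (Fin 5))) ≤ 3 := by
    rw [card_univ_sdiff, card_pair hij, Fintype.card_fin]
  exact no_clean_quad hq hε P hPinj (fun uv b => hA uv b) (univ \ {i, j}) hK c hcdeg hcP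

end Flat

/-! ### Nine points of `𝔽₂⁵` contain the four corners of an affine `2`-flat -/

/-- Corner `(0,0)`. [folklore] -/
theorem m_ff : ∀ a s t : Bool, (a ^^ ((false && s) ^^ (false && t))) = a := by decide

/-- Corner `(1,0)`. [folklore] -/
theorem m_tf : ∀ a a' t : Bool, (a ^^ ((true && (a ^^ a')) ^^ (false && t))) = a' := by decide

/-- Corner `(0,1)`. [folklore] -/
theorem m_ft : ∀ a s b : Bool, (a ^^ ((false && s) ^^ (true && (a ^^ b)))) = b := by decide

/-- Corner `(1,1)`. [folklore] -/
theorem m_tt : ∀ a a' b b' : Bool, (b ^^ b') = (a ^^ a') →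
    (a ^^ ((true && (a ^^ a')) ^^ (true && (a ^^ b)))) = b' := by decide

/-- Reading the reversed pair. [folklore] -/
theorem xc2 : ∀ a b c : Bool, (b ^^ c) = (a ^^ b) → c = a := by decide

/-- The four corners `a, b, a', b'` of the configuration. [folklore] -/
theorem corners (a a' b b' : Fin 5 → Bool) (hd : ∀ k, (b k ^^ b' k) = (a k ^^ a' k)) (u w : Bool) :
    (fun k => a k ^^ ((u && (a k ^^ a' k)) ^^ (w && (a k ^^ b k)))) =
      (bif u then (bif w then b' else a') else (bif w then b else a)) := by
  funext k
  cases u <;> cases w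
  · exact m_ff _ _ _
  · exact m_ft _ _ _
  · exact m_tf _ _ _
  · exact m_tt _ _ _ _ (hd k)

/-- **Pigeonhole.** Any `9` points of `𝔽₂⁵` contain four points `a₁, a₁ ⊕ s, a₁ ⊕ t, a₁ ⊕ s ⊕ t` with
`s, t ≠ 0`, `s ≠ t` (the `72` ordered differences take `31` values, so one value is taken three times, and two
non-reversed pairs with the same difference span such a configuration). [folklore] -/
theorem four_of_nine (C : Finset (Fin 5 → Bool)) (hC : 8 < #C) :
    ∃ a₁ s t : Fin 5 → Bool, s ≠ (fun _ => false) ∧ t ≠ (fun _ => false) ∧ s ≠ t ∧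
      ∀ uv : Bool × Bool, (fun k => a₁ k ^^ ((uv.1 && s k) ^^ (uv.2 && t k))) ∈ C := by
  classical
  obtain ⟨C', hC'C, hC'⟩ := exists_subset_card_eq (show 9 ≤ #C by omega)
  set d : (Fin 5 → Bool) × (Fin 5 → Bool) → (Fin 5 → Bool) := fun p k => p.1 k ^^ p.2 k with hd
  have hmaps : ∀ p ∈ C'.offDiag, d p ∈ univ.erase (fun _ => false) := by
    intro p hp
    rw [mem_erase]
    refine ⟨fun h0 => (mem_offDiag.mp hp).2.2 (funext fun k => xor_eq_false _ _ (congr_fun h0 k)), mem_univ _⟩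
  have hcard : #(univ.erase (fun _ : Fin 5 => false)) * 2 < #C'.offDiag := by
    rw [card_erase_of_mem (mem_univ _), card_univ, Fintype.card_fun, Fintype.card_bool, Fintype.card_fin,
      offDiag_card, hC']
    norm_num
  obtain ⟨v, -, hv⟩ := exists_lt_card_fiber_of_mul_lt_card_of_maps_to hmaps hcard
  obtain ⟨P₁, P₂, P₃, h₁, h₂, h₃, h12, h13, h23⟩ := two_lt_card_iff.mp hv
  -- a second pair which is neither `P₁` nor its reverse
  obtain ⟨Q, hQ, hQ1, hQ1'⟩ : ∃ Q, Q ∈ ({x ∈ C'.offDiag | d x = v} : Finset _) ∧ Q ≠ P₁ ∧ Q ≠ (P₁.2, P₁.1) := by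
    by_cases h : P₂ = (P₁.2, P₁.1)
    · exact ⟨P₃, h₃, fun e => h13 e.symm, fun e => h23 (h.trans e.symm)⟩
    · exact ⟨P₂, h₂, fun e => h12 e.symm, h⟩
  obtain ⟨hP₁off, hP₁v⟩ := mem_filter.mp h₁
  obtain ⟨hQoff, hQv⟩ := mem_filter.mp hQ
  obtain ⟨ha, ha', haa'⟩ := mem_offDiag.mp hP₁off
  obtain ⟨hb, hb', -⟩ := mem_offDiag.mp hQoff
  have hdiff : ∀ k, (Q.1 k ^^ Q.2 k) = (P₁.1 k ^^ P₁.2 k) := fun k => by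
    have e := congr_fun (hQv.trans hP₁v.symm) k
    simpa only [hd] using e
  have hba : Q.1 ≠ P₁.1 := fun e => hQ1 (Prod.ext e (funext fun k => by
    have := hdiff k; rw [e] at this; exact xor_cancel _ _ _ this))
  have hba' : Q.1 ≠ P₁.2 := fun e => hQ1' (Prod.ext e (funext fun k => by
    have := hdiff k; rw [e] at this; exact xc2 _ _ _ this))
  refine ⟨P₁.1, fun k => P₁.1 k ^^ P₁.2 k, fun k => P₁.1 k ^^ Q.1 k,
    fun h0 => haa' (funext fun k => xor_eq_false _ _ (congr_fun h0 k)),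
    fun h0 => hba (funext fun k => (xor_eq_false _ _ (congr_fun h0 k)).symm),
    fun hst => hba' (funext fun k => (xor_cancel _ _ _ (congr_fun hst k)).symm), ?_⟩
  rintro ⟨u, w⟩
  show (fun k => P₁.1 k ^^ ((u && (P₁.1 k ^^ P₁.2 k)) ^^ (w && (P₁.1 k ^^ Q.1 k)))) ∈ C
  rw [corners P₁.1 P₁.2 Q.1 Q.2 hdiff u w]
  cases u <;> cases w
  · exact hC'C ha
  · exact hC'C hb
  · exact hC'C ha'
  · exact hC'C hb'

/-! ### THEOREM MM59-W -/

/-- Pointwise cost in the budget: `(v - 4s)² ≥ 1`, and `≥ 9` when `v ≡ ±1 (mod 8)` (`v` odd, `s = ±1`).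
[folklore] -/
theorem pt_cost (v s : ℤ) (hv : Odd v) (hs : s = 1 ∨ s = -1) :
    1 + 8 * (if (v % 8 = 1 ∨ v % 8 = 7) then 1 else 0 : ℤ) ≤ (v - 4 * s) ^ 2 := by
  have h := tw12_pt v s hv hs
  have e : (Odd (v / 2) ↔ Odd (v / 2 / 2)) ↔ (v % 8 = 1 ∨ v % 8 = 7) := by
    have h1 := hv
    rw [Int.odd_iff] at h1
    rw [Int.odd_iff, Int.odd_iff]
    omega
  by_cases hc : (v % 8 = 1 ∨ v % 8 = 7)
  · rw [if_pos hc]; rw [if_pos (e.mpr hc)] at h; exact h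
  · rw [if_neg hc]; rw [if_neg (fun h' => hc (e.mp h'))] at h; exact h

/-- **THEOREM MM59-W.** For `g(x‖y) = x·φ(y) ⊕ h(y)` on `5 + 9` bits with `φ = (q₀,…,q₄)` quadratic and `h`
arbitrary, of TYPE O (`W_g = 2⁵u`, all `u` odd): `Φ(f,g) ≤ 59/64` for every Boolean `f` (no degree hypothesis
on `f` or `h`). NOT summit progress. [this work] -/
theorem typeO_mm59_forrelation_le (q : Fin 5 → (Fin 9 → Bool) → Bool) (hq : ∀ i, IsDegLeFun 2 (q i))
    (h : (Fin 9 → Bool) → Bool) (g : (Fin (5 + 9) → Bool) → Bool)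
    (hg : ∀ x y, signOf (g (Fin.append x y)) = twist x (fun i => q i y) * signOf (h y))
    (u : (Fin (5 + 9) → Bool) → ℤ) (hu : ∀ z, W (fun w => signOf (g w)) z = (2 : ℝ) ^ 5 * (u z : ℝ))
    (hodd : ∀ z, Odd (u z)) (f : (Fin (5 + 9) → Bool) → Bool) : forrelation f g ≤ 59 / 64 := by
  classical
  have hε := signWeight_odd h
  have e : ∀ a b, u (Fin.append a b) = fs q (signWeight h) a b := fun a b => by
    have := hu (Fin.append a b)
    rw [W_signForm q h g hg] at this
    exact_mod_cast (mul_left_cancel₀ (by positivity) this).symm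
  -- fibre totals are odd
  have hS : ∀ a, Odd (∑ y ∈ fib q a, signWeight h y) := fun a => by
    rw [← fs_zero, ← e]; exact hodd _
  -- per fibre: clean, or at least `128` exceptional points
  have hfib : ∀ a, (∀ b, fs q (signWeight h) a b % 8 = 3 ∨ fs q (signWeight h) a b % 8 = 5) ∨
      128 ≤ #{b : Fin 9 → Bool | fs q (signWeight h) a b % 8 = 1 ∨ fs q (signWeight h) a b % 8 = 7} := by
    intro a
    by_cases hcl : ∀ b, fs q (signWeight h) a b % 8 = 3 ∨ fs q (signWeight h) a b % 8 = 5
    · exact Or.inl hcl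
    · right
      push Not at hcl
      obtain ⟨b, hb3, hb5⟩ := hcl
      have hbodd := hodd (Fin.append a b)
      rw [e, Int.odd_iff] at hbodd
      have hb : fs q (signWeight h) a b % 8 = 1 ∨ fs q (signWeight h) a b % 8 = 7 := by omega
      exact exc_card_ge hε (hS a) ⟨b, hb⟩
  -- at most `8` clean fibres
  have hclean : #{a : Fin 5 → Bool | ∀ b, fs q (signWeight h) a b % 8 = 3 ∨ fs q (signWeight h) a b % 8 = 5} ≤ 8 := by
    by_contra hlt
    obtain ⟨a₁, s, t, hs, ht, hst, hmem⟩ := four_of_nine _ (not_le.mp hlt)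
    exact no_clean_flat hq hε a₁ s t hs ht hst fun uv b => (mem_filter.mp (hmem uv)).2 b
  -- hence `#E ≥ 24 · 128`
  have hEsum : (3072 : ℤ) ≤ ∑ z : Fin (5 + 9) → Bool, (if (u z % 8 = 1 ∨ u z % 8 = 7) then 1 else 0 : ℤ) := by
    have split : ∀ F : (Fin (5 + 9) → Bool) → ℤ,
        ∑ z, F z = ∑ a : Fin 5 → Bool, ∑ b : Fin 9 → Bool, F (Fin.append a b) := fun F => by
      rw [← (Fin.appendEquiv 5 9).sum_comp, Fintype.sum_prod_type]
      rfl
    rw [split]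
    have inner : ∀ a : Fin 5 → Bool,
        (∑ b : Fin 9 → Bool, (if (u (Fin.append a b) % 8 = 1 ∨ u (Fin.append a b) % 8 = 7) then 1 else 0 : ℤ)) =
          #{b : Fin 9 → Bool | fs q (signWeight h) a b % 8 = 1 ∨ fs q (signWeight h) a b % 8 = 7} := by
      intro a
      rw [← sum_boole]
      exact sum_congr rfl fun b _ => by rw [e]
    rw [sum_congr rfl fun a _ => inner a]
    set Cl : Finset (Fin 5 → Bool) :=
      {a | ∀ b, fs q (signWeight h) a b % 8 = 3 ∨ fs q (signWeight h) a b % 8 = 5} with hCl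
    have h1 : ∑ a ∈ univ \ Cl, (128 : ℤ) ≤ ∑ a ∈ univ \ Cl,
        (#{b : Fin 9 → Bool | fs q (signWeight h) a b % 8 = 1 ∨ fs q (signWeight h) a b % 8 = 7} : ℤ) :=
      sum_le_sum fun a ha => by
        have ha' : ¬ ∀ b, fs q (signWeight h) a b % 8 = 3 ∨ fs q (signWeight h) a b % 8 = 5 :=
          fun hcl => (mem_sdiff.mp ha).2 (by rw [hCl]; exact mem_filter.mpr ⟨mem_univ _, hcl⟩)
        exact_mod_cast (hfib a).resolve_left ha'
    have h2 : ∑ a ∈ univ \ Cl,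
        (#{b : Fin 9 → Bool | fs q (signWeight h) a b % 8 = 1 ∨ fs q (signWeight h) a b % 8 = 7} : ℤ) ≤
        ∑ a, (#{b : Fin 9 → Bool | fs q (signWeight h) a b % 8 = 1 ∨ fs q (signWeight h) a b % 8 = 7} : ℤ) :=
      sum_le_sum_of_subset_of_nonneg (subset_univ _) fun _ _ _ => by positivity
    have h3 : (24 : ℤ) ≤ #(univ \ Cl) := by
      have hc : #(univ \ Cl) = 32 - #Cl := by
        rw [card_univ_sdiff, Fintype.card_fun, Fintype.card_bool, Fintype.card_fin]; rfl
      have : 24 ≤ #(univ \ Cl) := by rw [hc]; omega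
      exact_mod_cast this
    rw [sum_const, nsmul_eq_mul] at h1
    nlinarith
  -- budget
  have hbud : ((∑ z : Fin (5 + 9) → Bool, (u z - 4 * sZ (f z)) ^ 2 : ℤ) : ℝ) =
      2 ^ 19 * (1 - forrelation f g) := fl_budget5 f g u hu
  have hpt : ∀ z : Fin (5 + 9) → Bool,
      1 + 8 * (if (u z % 8 = 1 ∨ u z % 8 = 7) then 1 else 0 : ℤ) ≤ (u z - 4 * sZ (f z)) ^ 2 :=
    fun z => pt_cost (u z) (sZ (f z)) (hodd z) (tp_sZ_cases (f z))
  set E : Finset (Fin (5 + 9) → Bool) := {z | u z % 8 = 1 ∨ u z % 8 = 7} with hEdef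
  have hsumE : (∑ z : Fin (5 + 9) → Bool, (if (u z % 8 = 1 ∨ u z % 8 = 7) then 1 else 0 : ℤ)) = #E := by
    rw [sum_boole]
  rw [hsumE] at hEsum
  have hlow : (16384 : ℤ) + 8 * #E ≤ ∑ z : Fin (5 + 9) → Bool, (u z - 4 * sZ (f z)) ^ 2 := by
    have hle := sum_le_sum fun z (_ : z ∈ (univ : Finset (Fin (5 + 9) → Bool))) => hpt z
    rw [sum_add_distrib, ← mul_sum, hsumE, sum_const, card_univ, Fintype.card_fun, Fintype.card_bool,
      Fintype.card_fin] at hle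
    norm_num at hle
    linarith
  have hlowR : (40960 : ℝ) ≤ ((∑ z : Fin (5 + 9) → Bool, (u z - 4 * sZ (f z)) ^ 2 : ℤ) : ℝ) := by
    have h' : (40960 : ℤ) ≤ ∑ z : Fin (5 + 9) → Bool, (u z - 4 * sZ (f z)) ^ 2 := by linarith
    exact_mod_cast h'
  rw [hbud] at hlowR
  linarith

end Summit.QuantumAdvantage.QuantumAdvantage.Theorems.NearExactIsExact.Negative.TypeOMM59WindowFourteen
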